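import Literature.MathematicalPhysics.QuantumLattice.WightmanTwoDimCone
import Literature.MathematicalPhysics.QuantumLattice.WightmanLocalTubeBV
import Literature.MathematicalPhysics.QuantumLattice.SchwingerSymmetryEuclid
import Literature.Analysis.Distribution.FourierLaplaceEdgeGrowth
import HarnessLib

/-!
# Symmetry of the Schwinger functions in two space-time dimensions (`d = 1`), and the named fact
`IsWickRotationOf.schwinger_symmetric` in every dimension

Topic `Literature/MathematicalPhysics/QuantumLattice` (trunk T-AQFT). The named fact
`IsWickRotationOf.schwinger_symmetric` (`SchwingerWightman`; Osterwalder–Schrader I (1973) §4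
(4.12) with (E3), §5 p. 97; Glimm–Jaffe (1987) Cor. 19.5.6; Streater–Wightman (1964) Thm. 3-6):
the Schwinger functions of a Wightman QFT of one hermitian scalar field extend from the time-ordered
region to functions real analytic and permutation symmetric at non-coincident Euclidean points. It
was proved for `d = 0` and `d ≥ 2` in `SchwingerSymmetryEuclid` through the Euclidean re-sorting
consistency `IsWightmanQFT.euclid_continuation_perm_eq` (for `d ≥ 2` by a common real Jost point of
`𝒯'ₙ ∩ σ𝒯'ₙ`, which does not exist in `d = 1`). This file proves the consistency in `d = 1` and
hence **the named fact in every space dimension** (`IsWickRotationOf.schwinger_symmetric_holds`).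

## The argument in `d = 1`

Fix an injective Euclidean configuration `x` (times `t`, positions `s`), its lexicographic order
`π = eSort x`, and an order `τ` along which the times are non-decreasing (the only orders that occur
as `eSort x'` for `x'` near `x`, `eventually_eSort_ne`); `τ` and `π` differ by a permutation within
the *levels* (groups of equal times). The level data `LevelData.ofConfig` (`WightmanTwoDimCone`)
provide a real base `O` (a small ball around `x₀ = (0, s)`), an open convex cone `Γ'` of imaginary
parts generated by `Y₁ e₀` (`Y₁ = N t + c + θ' ρ_τ`, increasing along `τ`) and
`Y₂ e₀ = (Y₁ + θ s) e₀` (increasing along `π`), and for every point `xr + iη` of the local tube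
`localTube O Γ' γ` imaginary Lorentz boosts (with point-dependent angles) taking `(xr + iη) ∘ τ` and
`(xr + iη) ∘ π` into the forward tube with margins `≥ κ₃‖η‖` (`LevelData.key_τ`, `LevelData.key_π`;
here `localTubeKey_τ/π`). By `WightmanLocalTubeBV` (Hörmander Thm. 3.1.15 with the edge growth of
the continued Wightman function) the two branches `𝔚(z ∘ τ)`, `𝔚(z ∘ π)` have boundary values
`T(φ ∘ (· ∘ τ⁻¹))`, `T(φ ∘ (· ∘ π⁻¹))` from the local tube, which agree by **local commutativity
within the levels** (`apply_permTest_π_eq_τ`: over `O` two distinct points of one level are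
space-like separated; the permutation `τ⁻¹π` is a product of same-level transpositions by bubble
sort of the keys, `Tuple.bubble_sort_induction'`, and a same-level transposition `(i j)` is a
product of adjacent ones, `apply_permTest_swap_eq_of_label`, S–W (3-34)); so the branches agree on
the whole local tube (`apply_perm_τ_eq_apply_perm_π`, uniqueness of boundary values on a local tube,
`LocalTubeUniqueness`). Finally (`perm_eq_eventually_of_levelCompat`) the local tube contains the
Euclidean point of the **anchor** (times `cA Y₁`, positions `s`), and the anchor and every `x'`
near `x` with `eSort x' = τ` lie in the convex set of configurations certified for `τ` and for `π`
(`certSet`, `WightmanEuclidSort`), whose Euclidean points lie in `τ𝒯'ₙ ∩ π𝒯'ₙ`; the identity theorem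
along this preconnected set carries `𝔚(e ∘ τ) = 𝔚(e ∘ π)` from the anchor to `e(x')`.

## Main statements

* `LevelData.ofConfig`, `LevelData.localTubeKey_τ`, `LevelData.localTubeKey_π`;
* `apply_permTest_swap_eq_of_label`, `LevelData.apply_permTest_π_eq_τ` (locality within levels);
* `LevelData.apply_perm_τ_eq_apply_perm_π` (the branches agree on the local tube);
* `perm_eq_eventually_of_levelCompat`, `perm_eSort_eq_nhds_one`;
* `IsWightmanQFT.euclid_continuation_perm_eq_holds_one`;
* **`IsWickRotationOf.schwinger_symmetric_holds_one`** and
  **`IsWickRotationOf.schwinger_symmetric_holds`** (every `d`).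

## References

* K. Osterwalder, R. Schrader, *Axioms for Euclidean Green's functions*, Comm. Math. Phys. 31
  (1973) 83–112, §4 (4.12), §5 p. 97. [OsterwalderSchraderCMP1973]
* J. Glimm, A. Jaffe, *Quantum Physics* (2nd ed. 1987), Cor. 19.5.6. [GlimmJaffeQP1987]
* R. F. Streater, A. S. Wightman, *PCT, Spin and Statistics, and All That* (1964), Thm. 2-10,
  Thm. 2-17, Thm. 3-2 (d) eq. (3-34), Thm. 3-6. [StreaterWightman1964]
* L. Hörmander, *The Analysis of Linear Partial Differential Operators I* (1990), Thm. 3.1.15.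
  [HormanderALPDO1]
-/

noncomputable section

open Filter Set Complex MeasureTheory
open _root_.Topology
open scoped SchwartzMap ContDiff
open Literature.MathematicalPhysics.QuantumFieldTheory Literature.Analysis.Distribution

namespace Literature.MathematicalPhysics.QuantumLattice

variable {n : ℕ}

/-! ### A positive lower bound for finitely many positive numbers -/

/-- Finitely many positive reals have a common positive lower bound `≤ 1`. [folklore] -/
theorem exists_pos_le_forall {ι : Type*} [Fintype ι] (f : ι → ℝ) (hf : ∀ i, 0 < f i) :
    ∃ δ : ℝ, 0 < δ ∧ δ ≤ 1 ∧ ∀ i, δ ≤ f i := by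
  by_cases hne : (Finset.univ : Finset ι).Nonempty
  · refine ⟨min 1 (Finset.univ.inf' hne f), lt_min one_pos ((Finset.lt_inf'_iff hne).2
      fun i _ => hf i), min_le_left _ _, fun i => (min_le_right _ _).trans
      (Finset.inf'_le f (Finset.mem_univ i))⟩
  · refine ⟨1, one_pos, le_rfl, fun i => ?_⟩
    exact absurd ⟨i, Finset.mem_univ i⟩ hne

/-! ### The level data of an injective Euclidean configuration -/

section OfConfig

variable {x : Fin n → EuclideanSpace ℝ (Fin (1 + 1))} {τ : Equiv.Perm (Fin n)}

/-- The gap of an injective configuration: a `δ₀ ∈ (0, 1]` below all non-zero time differences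
and below all position differences of distinct points with equal times. [folklore] -/
theorem exists_gap (hx : Function.Injective x) :
    ∃ δ₀ : ℝ, 0 < δ₀ ∧ δ₀ ≤ 1 ∧ (∀ P Q, x P 0 ≠ x Q 0 → δ₀ ≤ |x P 0 - x Q 0|) ∧
      (∀ P Q, P ≠ Q → x P 0 = x Q 0 → δ₀ ≤ |x P 1 - x Q 1|) := by
  classical
  set f : Fin n × Fin n → ℝ := fun pq =>
    if x pq.1 0 ≠ x pq.2 0 then |x pq.1 0 - x pq.2 0|
    else if pq.1 ≠ pq.2 then |x pq.1 1 - x pq.2 1| else 1 with hf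
  have hfpos : ∀ pq, 0 < f pq := by
    rintro ⟨P, Q⟩
    simp only [hf]
    split_ifs with h1 h2
    · exact abs_pos.2 (sub_ne_zero.2 h1)
    · push Not at h1
      refine abs_pos.2 (sub_ne_zero.2 fun h => h2 (hx ?_))
      ext μ
      fin_cases μ
      · exact h1
      · exact h
    · exact one_pos
  obtain ⟨δ, hδ, hδ1, hδf⟩ := exists_pos_le_forall f hfpos
  refine ⟨δ, hδ, hδ1, fun P Q h => ?_, fun P Q hPQ h => ?_⟩
  · have := hδf (P, Q)
    simp only [hf, h, ne_eq, not_false_eq_true, if_true] at this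
    exact this
  · have := hδf (P, Q)
    simp only [hf, h, ne_eq, not_true_eq_false, if_false, hPQ, not_false_eq_true, if_true] at this
    exact this

/-- Along the lexicographic sorting permutation the times are non-decreasing and, within equal
times, the positions are increasing (`d = 1`). [folklore] -/
theorem eSort_time_mono_and_pos_lt (hx : Function.Injective x) :
    (∀ k l, k ≤ l → x (eSort x k) 0 ≤ x (eSort x l) 0) ∧
      (∀ k l, k < l → x (eSort x k) 0 = x (eSort x l) 0 → x (eSort x k) 1 < x (eSort x l) 1) := by
  have hsm := strictMono_lexKey_eSort hx
  have key : ∀ k l, k < l → x (eSort x k) 0 < x (eSort x l) 0 ∨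
      (x (eSort x k) 0 = x (eSort x l) 0 ∧ x (eSort x k) 1 < x (eSort x l) 1) := by
    intro k l hkl
    obtain ⟨μ, hμ, hlt⟩ := (lexKey_lt_iff x _ _).1 (hsm hkl)
    fin_cases μ
    · exact Or.inl hlt
    · exact Or.inr ⟨hμ 0 (by decide), hlt⟩
  refine ⟨fun k l hkl => ?_, fun k l hkl heq => ?_⟩
  · rcases hkl.eq_or_lt with rfl | hkl'
    · exact le_rfl
    · rcases key k l hkl' with h | ⟨h, -⟩
      · exact h.le
      · exact h.le
  · rcases key k l hkl with h | ⟨-, h⟩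
    · exact absurd heq h.ne
    · exact h

/-- **The level data of an injective Euclidean configuration** `x` in `d = 1` with a level
compatible order `τ` (times non-decreasing along `τ`): times, positions, `τ`, `π = eSort x`,
`M = ‖x‖ + 1` and the gap `δ₀`. [folklore] -/
def LevelData.ofConfig (hx : Function.Injective x)
    (hτ : ∀ k l, k ≤ l → x (τ k) 0 ≤ x (τ l) 0) : LevelData n where
  t := fun P => x P 0
  s := fun P => x P 1
  τ := τ
  π := eSort x
  M := ‖x‖ + 1
  δ₀ := (exists_gap hx).choose
  one_le_M := by linarith [norm_nonneg x]
  abs_t_le := fun P => ((abs_apply_le_norm (x P) 0).trans (norm_le_pi_norm x P)).trans (by linarith)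
  abs_s_le := fun P => ((abs_apply_le_norm (x P) 1).trans (norm_le_pi_norm x P)).trans (by linarith)
  δ₀_pos := (exists_gap hx).choose_spec.1
  δ₀_le_one := (exists_gap hx).choose_spec.2.1
  t_τ_mono := hτ
  t_π_mono := (eSort_time_mono_and_pos_lt hx).1
  s_π_lt := (eSort_time_mono_and_pos_lt hx).2
  gap_t := (exists_gap hx).choose_spec.2.2.1
  gap_s := (exists_gap hx).choose_spec.2.2.2

/-- The times of the level data of `x`. [folklore] -/
@[simp] theorem LevelData.ofConfig_t (hx : Function.Injective x)
    (hτ : ∀ k l, k ≤ l → x (τ k) 0 ≤ x (τ l) 0) (P : Fin n) :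
    (LevelData.ofConfig hx hτ).t P = x P 0 := rfl
/-- The positions of the level data of `x`. [folklore] -/
@[simp] theorem LevelData.ofConfig_s (hx : Function.Injective x)
    (hτ : ∀ k l, k ≤ l → x (τ k) 0 ≤ x (τ l) 0) (P : Fin n) :
    (LevelData.ofConfig hx hτ).s P = x P 1 := rfl
/-- The level-compatible order of the level data. [folklore] -/
@[simp] theorem LevelData.ofConfig_τ (hx : Function.Injective x)
    (hτ : ∀ k l, k ≤ l → x (τ k) 0 ≤ x (τ l) 0) : (LevelData.ofConfig hx hτ).τ = τ := rfl
/-- The lexicographic order of the level data is `eSort x`. [folklore] -/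
@[simp] theorem LevelData.ofConfig_π (hx : Function.Injective x)
    (hτ : ∀ k l, k ≤ l → x (τ k) 0 ≤ x (τ l) 0) : (LevelData.ofConfig hx hτ).π = eSort x := rfl

end OfConfig

/-! ### The keys as local-tube keys -/

namespace LevelData

variable (D : LevelData n)

/-- From boost data (margins `≥ κ₃ ‖η‖`, real parts `≤ R'`, imaginary parts `≤ C₄ ‖η‖`) to the
local-tube key datum (an element of `L₊(ℂ)` and the ray form). [folklore] -/
theorem key_of_boost (σ : Equiv.Perm (Fin n)) {xr η : Fin n → SpaceTime 1} (hη0 : η ≠ 0) {φ : ℝ}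
    (hm : ∀ k, D.κ₃ * ‖η‖ ≤ coneMargin (imPart (succDiff
        (boostConfig n 0 ((φ : ℂ) * I) (fun k => rayC xr η I (σ k))) k)))
    (hre : ∀ k, ‖rePart (boostConfig n 0 ((φ : ℂ) * I) (fun k => rayC xr η I (σ k)) k)‖ ≤ D.R')
    (him : ∀ k, ‖imPart (boostConfig n 0 ((φ : ℂ) * I) (fun k => rayC xr η I (σ k)) k)‖ ≤
        D.C₄ * ‖η‖) :
    ∃ Λ ∈ properComplexLorentzGroup 1, ∃ x' η' : Fin n → SpaceTime 1,
      ‖x'‖ ≤ D.R' ∧ (∀ k, D.κ₃ ≤ coneMargin (succDiff η' k)) ∧ ‖η'‖ ≤ D.C₄ ∧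
      (fun k => Λ (rayC xr η I (σ k))) =
        fun k => complexifyPoint (x' k) + ((‖η‖ : ℂ) * I) • complexifyPoint (η' k) := by
  obtain ⟨Λ, hΛ, hΛeq⟩ := exists_lorentz_eq_boostConfig (n := n) (0 : Fin 1) ((φ : ℂ) * I)
  have hR : 0 ≤ D.R' := by unfold R'; linarith [D.M_pos]
  have hC : 0 ≤ D.C₄ := by unfold C₄; linarith [D.Yb_pos]
  obtain ⟨x', η', hx', hη', hη'n, hEq⟩ := exists_ray_form (norm_pos_iff.2 hη0) hR hC hm hre him
  refine ⟨Λ, hΛ, x', η', hx', hη', hη'n, ?_⟩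
  rw [hΛeq (fun k => rayC xr η I (σ k)), hEq]

/-- **The local-tube key of `τ`.** [folklore] -/
theorem localTubeKey_τ [NeZero n] : LocalTubeKey 1 D.τ D.O D.Γ' D.γ D.κ₃ D.R' D.C₄ := by
  intro xr hxr η hη hηγ
  have hη0 : η ≠ 0 := fun h =>
    zero_notMem_twoGenCone D.half_le_Y₁ D.half_le_Y₂ D.κ_le (h ▸ hη)
  obtain ⟨φ, hm, hre, him⟩ := D.key_τ hxr hη hηγ
  exact D.key_of_boost D.τ hη0 hm hre him

/-- **The local-tube key of `π`.** [folklore] -/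
theorem localTubeKey_π [NeZero n] : LocalTubeKey 1 D.π D.O D.Γ' D.γ D.κ₃ D.R' D.C₄ := by
  intro xr hxr η hη hηγ
  have hη0 : η ≠ 0 := fun h =>
    zero_notMem_twoGenCone D.half_le_Y₁ D.half_le_Y₂ D.κ_le (h ▸ hη)
  obtain ⟨φ, hm, hre, him⟩ := D.key_π hxr hη hηγ
  exact D.key_of_boost D.π hη0 hm hre him

end LevelData

/-! ### Local commutativity within the levels -/

section Locality

variable {d : ℕ} {T : 𝓢((Fin n → SpaceTime d), ℂ) →L[ℂ] ℂ}

variable (d) in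
/-- **Block space-like test functions** for a labelling `c` of the slots: compactly supported test
functions on whose support any two distinct slots with the same label carry space-like separated
points. [folklore] -/
def IsBlockSpacelike (c : Fin n → ℝ) (F : 𝓢((Fin n → SpaceTime d), ℂ)) : Prop :=
  HasCompactSupport (F : (Fin n → SpaceTime d) → ℂ) ∧
    ∀ u ∈ tsupport (F : (Fin n → SpaceTime d) → ℂ), ∀ a b : Fin n, a ≠ b → c a = c b →
      IsSpacelike (u a - u b)

/-- Block space-like test functions are stable under label-preserving permutations of the slots.
[folklore] -/
theorem IsBlockSpacelike.permTest {c : Fin n → ℝ} {F : 𝓢((Fin n → SpaceTime d), ℂ)}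
    (hF : IsBlockSpacelike d c F) {s : Equiv.Perm (Fin n)} (hs : ∀ k, c (s k) = c k) :
    IsBlockSpacelike d c (permTest s F) := by
  refine ⟨hasCompactSupport_permTest hF.1 s, fun u hu a b hab hc => ?_⟩
  rw [tsupport_permTest] at hu
  have hu' : (fun k => u (s k)) ∈ tsupport (F : (Fin n → SpaceTime d) → ℂ) := by
    simpa [permHomeo_apply] using hu
  have hab' : s.symm a ≠ s.symm b := fun h => hab (s.symm.injective h)
  have hc' : c (s.symm a) = c (s.symm b) := by
    rw [← hs (s.symm a), ← hs (s.symm b)]; simpa using hc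
  have h := hF.2 _ hu' (s.symm a) (s.symm b) hab' hc'
  simpa using h

/-- A transposition of two slots with the same label preserves the labelling. [folklore] -/
theorem label_swap_eq {c : Fin n → ℝ} {a b : Fin n} (h : c a = c b) (k : Fin n) :
    c (Equiv.swap a b k) = c k := by
  rcases eq_or_ne k a with rfl | hka
  · rw [Equiv.swap_apply_left]; exact h.symm
  rcases eq_or_ne k b with rfl | hkb
  · rw [Equiv.swap_apply_right]; exact h
  · rw [Equiv.swap_apply_of_ne_of_ne hka hkb]

/-- **Transpositions within a block act trivially** on a local distribution: if `T` is local
(adjacent transpositions of space-like separated arguments, S–W (3-34)), `F` is block space-like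
for the labelling `c`, and `c` is constant on the slots `i ≤ k ≤ j`, then
`T (F ∘ (i j)) = T F` — by induction on `j − i` through `(i j) = (k j)(i k)(k j)`, `k = j − 1`.
[cite: StreaterWightman1964, Thm 3-2 (d) eq. (3-34)] -/
theorem apply_permTest_swap_eq_of_label (hloc : IsLocalDistribution d n T) (c : Fin n → ℝ) :
    ∀ (m : ℕ) (i j : Fin n), (j : ℕ) = i + m + 1 → (∀ k : Fin n, i ≤ k → k ≤ j → c k = c i) →
      ∀ F : 𝓢((Fin n → SpaceTime d), ℂ), IsBlockSpacelike d c F →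
        T (permTest (Equiv.swap i j) F) = T F := by
  intro m
  induction m with
  | zero =>
    intro i j hj hc F hF
    have hij : i ≠ j := fun h => by rw [h] at hj; omega
    have hcij : c i = c j := (hc j (by rw [Fin.le_def]; omega) le_rfl).symm
    exact hloc i j (by omega) F hF.1 fun u hu => hF.2 u hu i j hij hcij
  | succ m ih =>
    intro i j hj hc F hF
    have hkn : (i : ℕ) + m + 1 < n := by have := j.isLt; omega
    set k : Fin n := ⟨(i : ℕ) + m + 1, hkn⟩ with hk
    have hkval : (k : ℕ) = (i : ℕ) + m + 1 := rfl
    have hik : i ≠ k := fun h => by have := congrArg Fin.val h; omega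
    have hij : i ≠ j := fun h => by rw [h] at hj; omega
    have hkj : k ≠ j := fun h => by have := congrArg Fin.val h; omega
    have hile : i ≤ k := by rw [Fin.le_def]; omega
    have hklj : k ≤ j := by rw [Fin.le_def]; omega
    have hci : c k = c i := hc k hile hklj
    have hcj : c j = c i := hc j (by rw [Fin.le_def]; omega) le_rfl
    have hckj : c k = c j := hci.trans hcj.symm
    have hcik : c i = c k := hci.symm
    -- `(i j) = (k j)(i k)(k j)`
    have hdec : Equiv.swap i j = Equiv.swap k j * Equiv.swap i k * Equiv.swap k j := by
      rw [Equiv.swap_mul_swap_mul_swap hik hij, Equiv.swap_comm]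
    -- the three test functions
    have hF₁ : IsBlockSpacelike d c (permTest (Equiv.swap k j) F) :=
      hF.permTest (label_swap_eq hckj)
    have hF₂ : IsBlockSpacelike d c (permTest (Equiv.swap i k) (permTest (Equiv.swap k j) F)) :=
      hF₁.permTest (label_swap_eq hcik)
    -- adjacent transpositions `(k j)`
    have hadj : ∀ G : 𝓢((Fin n → SpaceTime d), ℂ), IsBlockSpacelike d c G →
        T (permTest (Equiv.swap k j) G) = T G := fun G hG =>
      hloc k j (by omega) G hG.1 fun u hu => hG.2 u hu k j hkj hckj
    rw [hdec, permTest_mul, permTest_mul, hadj _ hF₂,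
      ih i k (by omega) (fun l hil hlk => hc l hil (hlk.trans hklj)) _ hF₁, hadj _ hF]

end Locality

namespace LevelData

variable (D : LevelData n) {T : 𝓢((Fin n → SpaceTime 1), ℂ) →L[ℂ] ℂ}

/-- Along any level-compatible order the times are the sorted times `t ∘ π`. [folklore] -/
theorem t_comp_eq_of_monotone {ρ : Equiv.Perm (Fin n)} (hρ : Monotone fun k => D.t (ρ k)) :
    (fun k => D.t (ρ k)) = fun k => D.t (D.π k) :=
  Tuple.unique_monotone (f := D.t) (σ := ρ) (τ := D.π) hρ fun k l hkl => D.t_π_mono k l hkl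

/-- **Permuted test functions supported over the real base are block space-like** for the
labelling by the sorted times: for a level-compatible `ρ` and `Φ` supported in `O`,
`Φ ∘ (· ∘ ρ⁻¹)` is block space-like (two slots with equal sorted times carry two distinct points
of the same level, which are space-like separated over `O`). [folklore] -/
theorem isBlockSpacelike_permTest {ρ : Equiv.Perm (Fin n)} (hρ : Monotone fun k => D.t (ρ k))
    {Φ : 𝓢((Fin n → SpaceTime 1), ℂ)} (hΦc : HasCompactSupport (Φ : (Fin n → SpaceTime 1) → ℂ))
    (hΦ : tsupport (Φ : (Fin n → SpaceTime 1) → ℂ) ⊆ D.O) :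
    IsBlockSpacelike 1 (fun k => D.t (D.π k)) (permTest ρ⁻¹ Φ) := by
  refine ⟨hasCompactSupport_permTest hΦc _, fun u hu a b hab hc => ?_⟩
  rw [tsupport_permTest] at hu
  have hu' : (fun k => u (ρ⁻¹ k)) ∈ D.O := hΦ (by simpa [permHomeo_apply] using hu)
  have ht := D.t_comp_eq_of_monotone hρ
  have hta : D.t (ρ a) = D.t (D.π a) := congr_fun ht a
  have htb : D.t (ρ b) = D.t (D.π b) := congr_fun ht b
  have h := D.isSpacelike_sub_of_mem_O hu' (P := ρ a) (Q := ρ b)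
    (fun h => hab (ρ.injective h)) (by rw [hta, htb]; exact hc)
  simpa using h

/-- The lexicographic key `(t, s)` of a particle. [folklore] -/
def key (P : Fin n) : Lex (ℝ × ℝ) := toLex (D.t P, D.s P)

/-- The key is strictly increasing along `π`. [folklore] -/
theorem strictMono_key_π : StrictMono fun k => D.key (D.π k) := by
  intro k l hkl
  show toLex (D.t (D.π k), D.s (D.π k)) < toLex (D.t (D.π l), D.s (D.π l))
  rw [Prod.Lex.toLex_lt_toLex]
  have ht := D.t_π_mono k l hkl.le
  rcases ht.eq_or_lt with h | h
  · exact Or.inr ⟨h, D.s_π_lt k l hkl h⟩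
  · exact Or.inl h

/-- The key is injective. [folklore] -/
theorem key_injective : Function.Injective D.key := by
  intro P Q h
  obtain ⟨k, rfl⟩ := D.π.surjective P
  obtain ⟨l, rfl⟩ := D.π.surjective Q
  rw [D.strictMono_key_π.injective h]

/-- `key Q < key P` forces `t Q ≤ t P`. [folklore] -/
theorem t_le_of_key_lt {P Q : Fin n} (h : D.key Q < D.key P) : D.t Q ≤ D.t P := by
  have h' : toLex (D.t Q, D.s Q) < toLex (D.t P, D.s P) := h
  rw [Prod.Lex.toLex_lt_toLex] at h'
  rcases h' with h' | ⟨h', -⟩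
  · exact h'.le
  · exact h'.le

/-- **Local commutativity within the levels**: for a local distribution `T` and a test function
`Φ` compactly supported over the real base `O`, `T (Φ ∘ (· ∘ π⁻¹)) = T (Φ ∘ (· ∘ τ⁻¹))` — the two
orders differ by a permutation within the levels, a product of transpositions of same-level slots
(bubble sort of the keys along `τ`), each acting trivially by `apply_permTest_swap_eq_of_label`.
[cite: StreaterWightman1964, Thm 3-2 (d) eq. (3-34)] -/
theorem apply_permTest_π_eq_τ (hloc : IsLocalDistribution 1 n T) (Φ : 𝓢((Fin n → SpaceTime 1), ℂ))
    (hΦc : HasCompactSupport (Φ : (Fin n → SpaceTime 1) → ℂ))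
    (hΦ : tsupport (Φ : (Fin n → SpaceTime 1) → ℂ) ⊆ D.O) :
    T (permTest D.π⁻¹ Φ) = T (permTest D.τ⁻¹ Φ) := by
  -- the keys along `τ` and their sorting permutation
  set g : Fin n → Lex (ℝ × ℝ) := fun k => D.key (D.τ k) with hg
  have hginj : Function.Injective g := D.key_injective.comp D.τ.injective
  set σ₀ : Equiv.Perm (Fin n) := Tuple.sort g with hσ₀
  have hsort : D.τ * σ₀ = D.π := by
    have h1 : Monotone (D.key ∘ ⇑(D.τ * σ₀)) := by
      have := Tuple.monotone_sort g
      refine fun k l hkl => ?_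
      have h := this hkl
      simpa [hg, Equiv.Perm.mul_apply] using h
    have h2 : Monotone (D.key ∘ ⇑D.π) := D.strictMono_key_π.monotone
    have h3 := Tuple.unique_monotone h1 h2
    ext k
    have := congr_fun h3 k
    exact congrArg Fin.val (D.key_injective this)
  -- bubble sort induction
  have hP : ∀ σ' : Equiv.Perm (Fin n), g ∘ ⇑(Tuple.sort g) = g ∘ ⇑σ' →
      Monotone (fun k => D.t ((D.τ * σ') k)) ∧
        T (permTest (D.τ * σ')⁻¹ Φ) = T (permTest D.τ⁻¹ Φ) := by
    refine Tuple.bubble_sort_induction' (P := fun g' => ∀ σ' : Equiv.Perm (Fin n), g' = g ∘ ⇑σ' →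
      Monotone (fun k => D.t ((D.τ * σ') k)) ∧
        T (permTest (D.τ * σ')⁻¹ Φ) = T (permTest D.τ⁻¹ Φ)) ?_ ?_
    · -- the base: `σ' = 1`
      intro σ' h
      have h1 : σ' = 1 := by
        ext k
        have := congr_fun h k
        exact congrArg Fin.val (hginj this).symm
      subst h1
      rw [mul_one]
      exact ⟨fun k l hkl => D.t_τ_mono k l hkl, rfl⟩
    · -- the step: an inversion `(i, j)` is a same-level transposition
      intro σ' i j hij hinv hIH σ'' hσ''
      obtain ⟨hmono, heq⟩ := hIH σ' rfl
      have h1 : σ'' = σ' * Equiv.swap i j := by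
        ext k
        have := congr_fun hσ'' k
        exact congrArg Fin.val (hginj this).symm
      subst h1
      set ρ : Equiv.Perm (Fin n) := D.τ * σ' with hρ
      -- the inversion: equal times on the slots `i ≤ k ≤ j`
      have hji : D.t (ρ j) ≤ D.t (ρ i) := D.t_le_of_key_lt (by simpa [hg, hρ] using hinv)
      have hij' : D.t (ρ i) ≤ D.t (ρ j) := hmono hij.le
      have htij : D.t (ρ i) = D.t (ρ j) := le_antisymm hij' hji
      have hconst : ∀ k : Fin n, i ≤ k → k ≤ j → D.t (ρ k) = D.t (ρ i) := fun k hik hkj =>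
        le_antisymm ((hmono hkj).trans hji) (hmono hik)
      -- the new order has the same times
      have htswap : (fun k => D.t ((D.τ * (σ' * Equiv.swap i j)) k)) = fun k => D.t (ρ k) := by
        funext k
        have e1 : (D.τ * (σ' * Equiv.swap i j)) k = ρ (Equiv.swap i j k) := by
          simp [hρ, Equiv.Perm.mul_apply]
        rw [e1]
        rcases eq_or_ne k i with rfl | hki
        · rw [Equiv.swap_apply_left]; exact htij.symm
        rcases eq_or_ne k j with rfl | hkj
        · rw [Equiv.swap_apply_right]; exact htij
        · rw [Equiv.swap_apply_of_ne_of_ne hki hkj]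
      refine ⟨by rw [htswap]; exact hmono, ?_⟩
      -- the transposition acts trivially
      have hc := D.t_comp_eq_of_monotone hmono
      have hlabel : ∀ k : Fin n, i ≤ k → k ≤ j → D.t (D.π k) = D.t (D.π i) := by
        intro k hik hkj
        have e1 : D.t (ρ k) = D.t (D.π k) := congr_fun hc k
        have e2 : D.t (ρ i) = D.t (D.π i) := congr_fun hc i
        rw [← e1, ← e2]; exact hconst k hik hkj
      have hinv_eq : (D.τ * (σ' * Equiv.swap i j))⁻¹ = Equiv.swap i j * ρ⁻¹ := by
        rw [← mul_assoc, ← hρ, mul_inv_rev, Equiv.swap_inv]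
      obtain ⟨m, hm⟩ : ∃ m : ℕ, (j : ℕ) = i + m + 1 := ⟨j - i - 1, by
        have := Fin.lt_def.1 hij; omega⟩
      rw [hinv_eq, permTest_mul, apply_permTest_swap_eq_of_label hloc (fun k => D.t (D.π k)) m i j hm
        hlabel _ (D.isBlockSpacelike_permTest hmono hΦc hΦ), heq]
  have h := (hP σ₀ rfl).2
  rwa [hsort] at h

end LevelData

/-! ### Euclidean points and inner products in `d = 1` -/

/-- In `d = 1` a Euclidean point is `x₀ + iy` with real part the positions and imaginary part the
times along `e₀`. [folklore] -/
theorem euclideanPoint_eq_rayC (y : Fin n → EuclideanSpace ℝ (Fin (1 + 1))) :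
    euclideanPoint y =
      rayC (fun k => EuclideanSpace.single (1 : Fin (1 + 1)) (y k 1)) (fun k => (y k 0) • e₀ 1) I := by
  funext k μ
  rw [rayC_apply]
  simp only [Pi.add_apply, Pi.smul_apply, complexifyPoint_apply, smul_eq_mul]
  fin_cases μ
  · simp [euclideanPoint, e₀_apply]
  · simp [euclideanPoint, e₀_apply]

/-- Inner products with `u_ε = (1, ε)` in `d = 1`. [folklore] -/
theorem inner_uPow_one (ε : ℝ) (v : EuclideanSpace ℝ (Fin (1 + 1))) :
    inner ℝ (uPow 1 ε) v = v 0 + ε * v 1 := by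
  rw [inner_uPow, Fin.sum_univ_two]
  simp

/-! ### The two branches agree on the local tube -/

namespace LevelData

variable (D : LevelData n)

/-- `κ₃ > 0`. [folklore] -/
theorem κ₃_pos : 0 < D.κ₃ := by
  have := D.θ'_pos; have := D.Yb_pos; unfold κ₃; positivity

/-- `γ ≤ 1/2`. [folklore] -/
theorem γ_le_half : D.γ ≤ 1 / 2 := D.γ_le.trans (by norm_num)

/-- The real base is open. [folklore] -/
theorem isOpen_O : IsOpen D.O := Metric.isOpen_ball
/-- The real base is convex. [folklore] -/
theorem convex_O : Convex ℝ D.O := convex_ball _ _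
/-- The base point lies in the real base. [folklore] -/
theorem x₀_mem_O : D.x₀ ∈ D.O := Metric.mem_ball_self D.δX_pos
/-- The cone of imaginary parts is open. [folklore] -/
theorem isOpen_Γ' : IsOpen D.Γ' := isOpen_twoGenCone
/-- The cone of imaginary parts is convex. [folklore] -/
theorem convex_Γ' : Convex ℝ D.Γ' := convex_twoGenCone D.κ_pos.le
/-- The cone of imaginary parts is a cone. [folklore] -/
theorem smul_mem_Γ' : ∀ c : ℝ, 0 < c → ∀ y ∈ D.Γ', c • y ∈ D.Γ' :=
  fun _ hc _ hy => smul_mem_twoGenCone hy hc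
/-- `0 ∉ Γ'` (for `n ≥ 1`). [folklore] -/
theorem zero_notMem_Γ' [NeZero n] : (0 : Fin n → SpaceTime 1) ∉ D.Γ' :=
  zero_notMem_twoGenCone D.half_le_Y₁ D.half_le_Y₂ D.κ_le

/-- **The branches `𝔚(z ∘ τ)` and `𝔚(z ∘ π)` agree on the local tube** of the level data: for
`𝔚` analytic and `L₊(ℂ)`-invariant on `𝒯'ₙ` with a local boundary value and edge growth, and `z`
in `localTube O Γ' γ`, `𝔚(z ∘ τ) = 𝔚(z ∘ π)` (`eqOn_perm_of_localTubeKey` with the two keys, the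
two ray directions and local commutativity within the levels). [cite: OsterwalderSchraderCMP1973, §5 p. 97] -/
theorem apply_perm_τ_eq_apply_perm_π [NeZero n] {𝔚 : (Fin n → Fin (1 + 1) → ℂ) → ℂ}
    {T : 𝓢((Fin n → SpaceTime 1), ℂ) →L[ℂ] ℂ} (h𝔚 : AnalyticOnNhd ℂ 𝔚 (relExtendedTube 1 n))
    (hbv : HasDistributionalBoundaryValue 𝔚 T) (hloc : IsLocalDistribution 1 n T)
    (hinv : ∀ Λ ∈ properComplexLorentzGroup 1, ∀ z ∈ relExtendedTube 1 n,
      𝔚 (fun k => Λ (z k)) = 𝔚 z)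
    (hgrowth : HasEdgeGrowth 𝔚) {z : Fin n → Fin (1 + 1) → ℂ} (hz : z ∈ localTube D.O D.Γ' D.γ) :
    𝔚 (fun k => z (D.τ k)) = 𝔚 (fun k => z (D.π k)) :=
  eqOn_perm_of_localTubeKey D.localTubeKey_τ D.localTubeKey_π D.κ₃_pos D.κ₃_pos D.γ_pos
    D.γ_le_half D.isOpen_O D.convex_O D.isOpen_Γ' D.convex_Γ' D.smul_mem_Γ' D.zero_notMem_Γ' h𝔚 hbv
    hinv hgrowth D.ητ_mem D.ητ_perm_mem_tubeCone D.ηπ_mem D.ηπ_perm_mem_tubeCone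
    (fun _ hφ hφc hφO => (D.apply_permTest_π_eq_τ hloc (hφc.toSchwartzMap hφ) hφc hφO).symm) hz

/-! ### Euclidean points, the anchor and the certificates -/

/-- The anchor amplitude `cA = min (γ/(2(Yb+1))) δ₀`. [folklore] -/
def cA : ℝ := min (D.γ / (2 * (D.Yb + 1))) D.δ₀
/-- `cA > 0`. [folklore] -/
theorem cA_pos : 0 < D.cA := lt_min (by have := D.γ_pos; have := D.Yb_pos; positivity) D.δ₀_pos
/-- `cA Yb < γ`. [folklore] -/
theorem cA_Yb_lt : D.cA * D.Yb < D.γ := by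
  have h1 : D.cA ≤ D.γ / (2 * (D.Yb + 1)) := min_le_left _ _
  have hγ := D.γ_pos; have hYb := D.Yb_pos
  have h2 : D.γ / (2 * (D.Yb + 1)) * D.Yb < D.γ := by
    rw [div_mul_eq_mul_div, div_lt_iff₀ (by positivity)]; nlinarith
  nlinarith [D.cA_pos]
/-- `cA ≤ δ₀`. [folklore] -/
theorem cA_le_δ₀ : D.cA ≤ D.δ₀ := min_le_right _ _

/-- **The anchor**: the Euclidean configuration with times `cA Y₁` and the positions `s`.
[folklore] -/
def anchor : Fin n → EuclideanSpace ℝ (Fin (1 + 1)) := fun P => WithLp.toLp 2 ![D.cA * D.Y₁ P, D.s P]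

/-- Times of the anchor. [folklore] -/
@[simp] theorem anchor_apply_zero (P : Fin n) : D.anchor P 0 = D.cA * D.Y₁ P := by
  simp [anchor]
/-- Positions of the anchor. [folklore] -/
@[simp] theorem anchor_apply_one (P : Fin n) : D.anchor P 1 = D.s P := by
  simp [anchor]

/-- The Euclidean point of the anchor is `x₀ + i cA η_τ`. [folklore] -/
theorem euclideanPoint_anchor : euclideanPoint D.anchor = rayC D.x₀ (D.cA • D.ητ) I := by
  rw [euclideanPoint_eq_rayC]
  have h1 : (fun k => EuclideanSpace.single (1 : Fin (1 + 1)) (D.anchor k 1)) = D.x₀ := by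
    funext k; rw [anchor_apply_one]; rfl
  have h2 : (fun k => (D.anchor k 0) • e₀ 1) = D.cA • D.ητ := by
    funext k
    rw [anchor_apply_zero, Pi.smul_apply]
    show (D.cA * D.Y₁ k) • e₀ 1 = D.cA • (D.Y₁ k • e₀ 1)
    rw [smul_smul]
  rw [h1, h2]

/-- **The Euclidean point of the anchor lies in the local tube.** [folklore] -/
theorem euclideanPoint_anchor_mem : euclideanPoint D.anchor ∈ localTube D.O D.Γ' D.γ := by
  rw [D.euclideanPoint_anchor, rayC_I_mem_localTube_iff]
  refine ⟨D.x₀_mem_O, D.smul_mem_Γ' _ D.cA_pos _ D.ητ_mem, ?_⟩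
  rw [norm_smul, Real.norm_eq_abs, abs_of_pos D.cA_pos]
  exact lt_of_le_of_lt (mul_le_mul_of_nonneg_left D.norm_ητ_le D.cA_pos.le) D.cA_Yb_lt

/-- The anchor is certified for `π` with `ε' = cA/(8M)`. [folklore] -/
theorem anchor_mem_certSet_π : D.anchor ∈ certSet n D.π (uPow 1 (D.cA / (8 * D.M))) := by
  rw [mem_certSet_iff]
  have h := D.strictMono_anchor_π D.cA_pos
  intro k l hkl
  simp only [inner_uPow_one, anchor_apply_zero, anchor_apply_one]
  exact h hkl

/-- The anchor is certified for `τ` with any `0 < ε` with `4 ε M < cA θ'`. [folklore] -/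
theorem anchor_mem_certSet_τ {ε : ℝ} (hε : 0 < ε) (hεM : 4 * ε * D.M < D.cA * D.θ') :
    D.anchor ∈ certSet n D.τ (uPow 1 ε) := by
  rw [mem_certSet_iff]
  have h := D.strictMono_anchor_τ D.cA_pos hε hεM
  intro k l hkl
  simp only [inner_uPow_one, anchor_apply_zero, anchor_apply_one]
  exact h hkl

end LevelData

/-! ### The Euclidean re-sorting consistency in `d = 1` -/

section Consistency

variable {𝔚 : (Fin n → Fin (1 + 1) → ℂ) → ℂ} {T : 𝓢((Fin n → SpaceTime 1), ℂ) →L[ℂ] ℂ}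
  {x : Fin n → EuclideanSpace ℝ (Fin (1 + 1))}

/-- Along the lexicographic sorting permutation of any configuration the times are
non-decreasing. [folklore] -/
theorem time_eSort_mono (y : Fin n → EuclideanSpace ℝ (Fin (1 + 1))) {k l : Fin n} (hkl : k ≤ l) :
    y (eSort y k) 0 ≤ y (eSort y l) 0 := by
  have h := monotone_lexKey_eSort y hkl
  rcases h.eq_or_lt with h | h
  · have := congr_fun (toLex.injective h : (fun μ => y (eSort y k) μ) = fun μ => y (eSort y l) μ) 0
    exact this.le
  · obtain ⟨μ, hμ, hlt⟩ := (lexKey_lt_iff y _ _).1 h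
    by_cases hμ0 : μ = 0
    · subst hμ0; exact hlt.le
    · exact (hμ 0 (Fin.pos_iff_ne_zero.2 hμ0)).le

/-- If `τ` is not level compatible for `x` (the times decrease somewhere along `τ`), then
`eSort x' ≠ τ` for all `x'` near `x`. [folklore] -/
theorem eventually_eSort_ne {τ : Equiv.Perm (Fin n)} (hτ : ¬ ∀ k l, k ≤ l → x (τ k) 0 ≤ x (τ l) 0) :
    ∀ᶠ x' in 𝓝 x, eSort x' ≠ τ := by
  push Not at hτ
  obtain ⟨k, l, hkl, hlt⟩ := hτ
  have hopen : IsOpen {x' : Fin n → EuclideanSpace ℝ (Fin (1 + 1)) | x' (τ l) 0 < x' (τ k) 0} :=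
    isOpen_lt ((EuclideanSpace.proj (0 : Fin (1 + 1))).continuous.comp (continuous_apply (τ l)))
      ((EuclideanSpace.proj (0 : Fin (1 + 1))).continuous.comp (continuous_apply (τ k)))
  filter_upwards [hopen.mem_nhds hlt] with x' hx' heq
  have := time_eSort_mono x' hkl
  rw [heq] at this
  exact absurd hx' (not_lt.2 this)

/-- **Consistency for a level-compatible order** (the heart of the `d = 1` case). Let `𝔚` be
analytic and `L₊(ℂ)`-invariant on `𝒯'ₙ` with local boundary value and edge growth, `x` injective,
`τ` level compatible for `x`, `D` the level data of `(x, τ)`. Then for all `x'` near `x` with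
`eSort x' = τ`, `𝔚(e(x') ∘ τ) = 𝔚(e(x') ∘ eSort x)`: the difference of the two branches vanishes on
the local tube of `D` (`apply_perm_τ_eq_apply_perm_π`), in particular near the Euclidean point of
the anchor; the anchor and `x'` both lie in the convex set of configurations certified for `τ` (by
`u_ε`, `ε` small) and for `π = eSort x` (by `u_{ε'}`), whose Euclidean points lie in
`τ𝒯'ₙ ∩ π𝒯'ₙ`; the identity theorem along this preconnected set carries the vanishing to `e(x')`.
[cite: OsterwalderSchraderCMP1973, §5 p. 97] -/
theorem perm_eq_eventually_of_levelCompat [NeZero n] (hx : Function.Injective x)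
    {τ : Equiv.Perm (Fin n)} (hτ : ∀ k l, k ≤ l → x (τ k) 0 ≤ x (τ l) 0)
    (h𝔚 : AnalyticOnNhd ℂ 𝔚 (relExtendedTube 1 n)) (hbv : HasDistributionalBoundaryValue 𝔚 T)
    (hloc : IsLocalDistribution 1 n T)
    (hinv : ∀ Λ ∈ properComplexLorentzGroup 1, ∀ z ∈ relExtendedTube 1 n,
      𝔚 (fun k => Λ (z k)) = 𝔚 z)
    (hgrowth : HasEdgeGrowth 𝔚) :
    ∀ᶠ x' in 𝓝 x, eSort x' = τ →
      𝔚 (fun k => euclideanPoint x' (τ k)) = 𝔚 (fun k => euclideanPoint x' (eSort x k)) := by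
  set D : LevelData n := LevelData.ofConfig hx hτ with hD
  set π : Equiv.Perm (Fin n) := eSort x with hπ
  have hDτ : D.τ = τ := rfl
  have hDπ : D.π = π := rfl
  -- the certificate of `π` with `ε' = cA/(8M)`, for all configurations near `x`
  set ε' : ℝ := D.cA / (8 * D.M) with hε'
  have hε'pos : 0 < ε' := by have := D.cA_pos; have := D.M_pos; positivity
  have hxπ : x ∈ certSet n π (uPow 1 ε') := by
    rw [mem_certSet_iff]
    have h := D.strictMono_config_π hε'pos (by
      have h1 : 4 * ε' * D.M = D.cA / 2 := by rw [hε']; have := D.M_pos; field_simp; ring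
      rw [h1]; linarith [D.cA_le_δ₀, D.cA_pos])
    intro k l hkl
    simp only [inner_uPow_one]
    exact h hkl
  have hN := eventually_strictMono_inner_nhds (σ := π) (u := uPow 1 ε') (x := x) hxπ
  filter_upwards [hN, eventually_injective_nhds hx] with x' hx'π hx'inj hsort
  -- the certificate of `τ` for `x'` and the anchor, with a small `ε`
  obtain ⟨ε, hεpos, hεM, hε⟩ : ∃ ε : ℝ, 0 < ε ∧ 4 * ε * D.M < D.cA * D.θ' ∧
      StrictMono fun k => inner ℝ (uPow 1 ε) (x' (τ k)) := by
    have h1 : ∀ᶠ ε in 𝓝[>] (0 : ℝ), 4 * ε * D.M < D.cA * D.θ' := by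
      have hc : Continuous fun ε : ℝ => 4 * ε * D.M := by fun_prop
      have h0 : (fun ε : ℝ => 4 * ε * D.M) 0 < D.cA * D.θ' := by
        simp only [mul_zero, zero_mul]; exact mul_pos D.cA_pos D.θ'_pos
      exact nhdsWithin_le_nhds ((hc.tendsto 0).eventually (gt_mem_nhds h0))
    have h2 := eventually_strictMono_inner_uPow_eSort hx'inj
    rw [hsort] at h2
    obtain ⟨ε, ⟨⟨h3, h4⟩, h5⟩⟩ := ((h2.and h1).and self_mem_nhdsWithin).exists
    exact ⟨ε, h5, h4, h3⟩
  set u : EuclideanSpace ℝ (Fin (1 + 1)) := uPow 1 ε with hu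
  set u' : EuclideanSpace ℝ (Fin (1 + 1)) := uPow 1 ε' with hu'
  -- the convex certified set and its Euclidean image
  set Q : Set (Fin n → EuclideanSpace ℝ (Fin (1 + 1))) := certSet n τ u ∩ certSet n π u' with hQ
  have hQc : Convex ℝ Q := (convex_certSet τ u).inter (convex_certSet π u')
  have hx'Q : x' ∈ Q := ⟨hε, hx'π⟩
  have haQ : D.anchor ∈ Q := ⟨D.anchor_mem_certSet_τ hεpos hεM, D.anchor_mem_certSet_π⟩
  set U : Set (Fin n → Fin (1 + 1) → ℂ) := euclideanPoint '' Q with hU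
  have hUpre : IsPreconnected U :=
    hQc.isPreconnected.image _ (euclideanPointCLM 1 n).continuous.continuousOn
  -- the difference of the two branches, analytic near `U`
  set H : (Fin n → Fin (1 + 1) → ℂ) → ℂ := fun Z => 𝔚 (fun k => Z (τ k)) - 𝔚 (fun k => Z (π k))
    with hH
  have hHan : AnalyticOnNhd ℂ H U := by
    rintro _ ⟨q, hq, rfl⟩
    have h1 : (fun k => euclideanPoint q (τ k)) ∈ relExtendedTube 1 n :=
      euclideanPoint_perm_mem_relExtendedTube_of_mem_certSet (m := 0) (uPow_ne_zero ε) hq.1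
    have h2 : (fun k => euclideanPoint q (π k)) ∈ relExtendedTube 1 n :=
      euclideanPoint_perm_mem_relExtendedTube_of_mem_certSet (m := 0) (uPow_ne_zero ε') hq.2
    exact ((h𝔚 _ h1).comp (analyticAt_permConfig τ _)).sub
      ((h𝔚 _ h2).comp (analyticAt_permConfig π _))
  -- `H = 0` near the Euclidean point of the anchor (a point of the local tube)
  have hev : H =ᶠ[𝓝 (euclideanPoint D.anchor)] 0 := by
    have ho : IsOpen (localTube D.O D.Γ' D.γ) := isOpen_localTube D.isOpen_O D.isOpen_Γ' _
    filter_upwards [ho.mem_nhds D.euclideanPoint_anchor_mem] with Z hZ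
    exact sub_eq_zero.2 (D.apply_perm_τ_eq_apply_perm_π h𝔚 hbv hloc hinv hgrowth hZ)
  have haU : euclideanPoint D.anchor ∈ U := ⟨_, haQ, rfl⟩
  have hzero := hHan.eqOn_zero_of_preconnected_of_eventuallyEq_zero hUpre haU hev
  have h := hzero ⟨_, hx'Q, rfl⟩
  exact sub_eq_zero.1 h

/-- **Euclidean re-sorting consistency in `d = 1`.** For `𝔚` analytic and `L₊(ℂ)`-invariant on
`𝒯'ₙ` with local boundary value and edge growth and an injective Euclidean configuration `x`:
`𝔚(e(x') ∘ eSort x') = 𝔚(e(x') ∘ eSort x)` for all `x'` near `x` (finitely many orders `τ`; the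
level-compatible ones by `perm_eq_eventually_of_levelCompat`, the others do not occur as `eSort x'`
near `x`). [cite: OsterwalderSchraderCMP1973, §5 p. 97] -/
theorem perm_eSort_eq_nhds_one (h𝔚 : AnalyticOnNhd ℂ 𝔚 (relExtendedTube 1 n))
    (hbv : HasDistributionalBoundaryValue 𝔚 T) (hloc : IsLocalDistribution 1 n T)
    (hinv : ∀ Λ ∈ properComplexLorentzGroup 1, ∀ z ∈ relExtendedTube 1 n,
      𝔚 (fun k => Λ (z k)) = 𝔚 z)
    (hgrowth : HasEdgeGrowth 𝔚) (hx : Function.Injective x) :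
    ∀ᶠ x' in 𝓝 x, 𝔚 (fun k => euclideanPoint x' (eSort x' k)) =
      𝔚 (fun k => euclideanPoint x' (eSort x k)) := by
  rcases Nat.eq_zero_or_pos n with hn | hn
  · subst hn
    refine Eventually.of_forall fun x' => ?_
    congr 1
  haveI : NeZero n := NeZero.of_pos hn
  have key : ∀ τ : Equiv.Perm (Fin n), ∀ᶠ x' in 𝓝 x, eSort x' = τ →
      𝔚 (fun k => euclideanPoint x' (τ k)) = 𝔚 (fun k => euclideanPoint x' (eSort x k)) := by
    intro τ
    by_cases hτ : ∀ k l, k ≤ l → x (τ k) 0 ≤ x (τ l) 0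
    · exact perm_eq_eventually_of_levelCompat hx hτ h𝔚 hbv hloc hinv hgrowth
    · filter_upwards [eventually_eSort_ne hτ] with x' hx' h
      exact absurd h hx'
  filter_upwards [Filter.eventually_all.2 key] with x' hx'
  exact hx' (eSort x') rfl

end Consistency

/-! ### The named fact holds in `d = 1`, hence in every dimension -/

section Holds

variable {d : ℕ} {κ : Type*}

/-- **Euclidean re-sorting consistency holds in space dimension `d = 1`**
(`IsWightmanQFT.euclid_continuation_perm_eq`, the Euclidean-point instance of S–W Thm. 3-6 /
OS I §5 p. 97), with the edge growth of the continued Wightman function supplied by the spectral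
condition (`IsWightmanQFT.hasSpectralCondition_family_holds`) and the Fourier–Laplace
representation with edge growth (`fourierLaplace_coneSupport_edgeGrowth_holds`, S–W Thm. 2-10).
[cite: OsterwalderSchraderCMP1973, §5 p. 97] -/
theorem IsWightmanQFT.euclid_continuation_perm_eq_holds_one :
    IsWightmanQFT.euclid_continuation_perm_eq (d := 1) (κ := κ) := by
  intro W hW n k hk 𝔚 h𝔚 hT hinv x hx
  obtain ⟨T, hTW, hbv⟩ := hT
  refine ⟨euclideanPoint_eSort_mem_relExtendedTube (m := 0) hx, ?_⟩
  -- edge growth from the spectral condition and the Fourier–Laplace representation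
  have hgrowth : HasEdgeGrowth 𝔚 := by
    obtain ⟨𝒲, h𝒲, -⟩ := IsWightmanQFT.existsUnique_wightmanFamily_holds (W := W) hW
    have hspec := IsWightmanQFT.hasSpectralCondition_family_holds (W := W) hW h𝒲
    have hTeq : T = 𝒲 n k :=
      ContinuousLinearMap.ext_on (denseSpan_tensorProducts_holds (E := SpaceTime 1) n) (by
        rintro F ⟨f, hF⟩
        rw [hTW _ F hF, h𝒲 n k _ F hF])
    have hFS : FourierSupportedIn T (Literature.Analysis.FunctionSpaces.spectralSet 1 n) := by
      rw [hTeq]; exact hspec n k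
    exact hasEdgeGrowth_of_fourierSupportedIn (h𝔚.differentiableOn.mono
      (QuantumFieldTheory.forwardTube_subset_relForwardTube.trans relForwardTube_subset_relExtendedTube))
      hbv hFS fourierLaplace_coneSupport_edgeGrowth_holds
  exact perm_eSort_eq_nhds_one h𝔚 hbv (hW.isLocalDistribution hTW hk) hinv hgrowth hx

/-- **Symmetry and real analyticity of the Schwinger functions in space dimension `d = 1`: the
named fact `IsWickRotationOf.schwinger_symmetric` holds in two space-time dimensions**
(OS I §4 (4.12)+(E3), §5 p. 97; Glimm–Jaffe Cor. 19.5.6; S–W Thm. 3-6), by the assembly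
`IsWickRotationOf.schwinger_symmetric_of_euclid` with the discharged uniqueness of boundary values,
invariant continuation (spectral condition, Fourier–Laplace, Bargmann–Hall–Wightman), tensor
density, and `IsWightmanQFT.euclid_continuation_perm_eq_holds_one`.
[cite: OsterwalderSchraderCMP1973, §5 p. 97] -/
theorem IsWickRotationOf.schwinger_symmetric_holds_one :
    IsWickRotationOf.schwinger_symmetric (d := 1) (κ := κ) :=
  IsWickRotationOf.schwinger_symmetric_of_euclid eq_zero_of_distributionalBoundaryValue_zero_holds
    (IsWightmanQFT.exists_invariant_continuation_of_spectral_of_laplace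
      (fun _ => IsWightmanQFT.hasSpectralCondition_family_holds)
      fun _ => fourierLaplace_coneSupport_holds)
    denseSpan_tensorProducts_holds IsWightmanQFT.euclid_continuation_perm_eq_holds_one

/-- **The named fact `IsWickRotationOf.schwinger_symmetric` holds in every space dimension `d`**
(symmetry and real analyticity of the Schwinger functions of a Wightman QFT of one hermitian
scalar field at non-coincident Euclidean points; Osterwalder–Schrader I §5 p. 97, Glimm–Jaffe
Cor. 19.5.6, Streater–Wightman Thm. 3-6): `d = 0` and `d ≥ 2` by
`schwinger_symmetric_holds_of_ne_one` (`SchwingerSymmetryEuclid`), `d = 1` by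
`schwinger_symmetric_holds_one`. [cite: OsterwalderSchraderCMP1973, §5 p. 97] -/
theorem IsWickRotationOf.schwinger_symmetric_holds :
    IsWickRotationOf.schwinger_symmetric (d := d) (κ := κ) := by
  by_cases hd : d = 1
  · subst hd
    exact IsWickRotationOf.schwinger_symmetric_holds_one
  · exact IsWickRotationOf.schwinger_symmetric_holds_of_ne_one hd

end Holds

end Literature.MathematicalPhysics.QuantumLattice
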